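import Summits.MatrixMultiplication.MatrixMultiplication.Theorems.SoloInformedSupportSubrankInstability
import HarnessLib

/-!
# Support-subrank for direct powers, II: triangular re-weightings and the Ellenberg–Gijswijt count
# at the rank of one coordinate (engine of Theorem C_p)

Solo-informed seat (MatrixMultiplication), gen 109 (paper/theoremB2.md §9.7).

**Theorem C_p (paper).** For a prime `p` and `H ≤ 𝔽_pˣ` of order `h`, the modular adjacency algebra
`𝔽_p·Cyc(p,H)` of the cyclotomic scheme `Cyc(p,H) = 𝒮(𝔽_p, H)` (rank `r₀ = 1 + (p-1)/h`) is the
truncated polynomial ring `𝔽_p[s]/(s^{r₀})`, `s = (class sum of H) − h`; hence its structure tensor in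
the CLASS basis — whose support is exactly the triangle support, since `0 < p_{CD}^E ≤ h < p` on
triangles — is a TRUNCATED CONVOLUTION `F(x,y,z) = Σ_{a+b<r₀} Λ_{xa} Λ_{yb} M_{a+b,z}` and has triangle
rank `≤ r₀` (BCCGNSU (4.9)). This file proves the two basis-free steps:
`hasTriangleRankLE_of_truncatedConvolution` (a truncated convolution through `m` levels has triangle
rank `≤ m`) and, with BCCGNSU Prop. 4.13 (proved in the tree) and the support-subrank principle for
powers, `realizationPow_behrend_le_of_hasTriangleRankLE` /
`realizationPow_behrend_le_of_truncatedConvolution`: if the triangle support of a rank-`m`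
configuration carries a triangular re-weighting over some field, every realization of `⟨3N,3N,3N⟩`
in the `k`-th direct power satisfies `N² e^{-4√log N} ≤ 3·(m·J(m))^k` — the Ellenberg–Gijswijt /
BCCGNSU count at `m = r₀`, not at `p` (`2J(2) = 1.88988…` recovers Theorem S). The scheme-side
dictionary (`𝔽_p·Cyc(p,H) = 𝔽_p[s]/(s^{r₀})`) is on paper (theoremB2 §9.7) and not yet typed.

References: CohnUmans2013 (arXiv:1207.6528) §5, Conj. 21; BlasiakChurchCohnGrochowNaslundSawinUmans2017
(arXiv:1605.06702) (4.9), Prop. 4.13; EllenbergGijswijt2017.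
-/

noncomputable section

open scoped BigOperators
open Finset Literature.Combinatorics.Additive
open Literature.Barriers.MatrixMultiplication (sliceRank bccgnsuJ)
open Literature.Computability.AlgebraicComplexity (kroneckerPow HasTriangleRankLE
  BCCGNSU2017_prop413_holds)

namespace Summit.MatrixMultiplication.MatrixMultiplication.Theorems.SupportSubrank

variable {Cl : Type} {K : Type} [Field K]

/-- **A truncated convolution through `m` levels has triangle rank `≤ m`.** If
`F(x,y,z) = Σ_{a,b<m, a+b<m} Λ_{x,a} Λ_{y,b} M_{a+b,z}` (the structure tensor, in an arbitrary basis
`e_x = Σ_a Λ_{x,a} s^a`, of a commutative algebra `K[s]/(s^m)`, with `s^j = Σ_z M_{j,z} e_z`), then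
`F = Σ_{a+b+c = m-1} Λ_{x,a} Λ_{y,b} M_{m-1-c,z}` is a triangular decomposition (BCCGNSU (4.9)).
[this work] -/
theorem hasTriangleRankLE_of_truncatedConvolution (m : ℕ) (Λ : Cl → Fin m → K) (M : Fin m → Cl → K)
    (F : Cl → Cl → Cl → K)
    (hF : ∀ x y z, F x y z = ∑ a : Fin m, ∑ b : Fin m,
      if h : (a : ℕ) + b < m then Λ x a * Λ y b * M ⟨a + b, h⟩ z else 0) :
    HasTriangleRankLE F m := by
  classical
  refine ⟨fun a x => Λ x a, fun b y => Λ y b, fun c z => M (Fin.rev c) z,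
    fun a b c => if (a : ℕ) + b + c = m - 1 then 1 else 0, fun x y z => ?_⟩
  rw [hF]
  refine Finset.sum_congr rfl fun a _ => Finset.sum_congr rfl fun b _ => ?_
  by_cases hab : (a : ℕ) + b < m
  · rw [dif_pos hab]
    have hc0 : m - 1 - (a + b) < m := by omega
    rw [Finset.sum_eq_single (⟨m - 1 - (a + b), hc0⟩ : Fin m)]
    · have h2 : (a : ℕ) + b + (m - 1 - (a + b)) = m - 1 := by omega
      have h3 : Fin.rev (⟨m - 1 - (a + b), hc0⟩ : Fin m) = ⟨a + b, hab⟩ := by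
        ext; simp [Fin.val_rev]; omega
      have h4 : m - 1 < m := by omega
      simp only [h2, h4, if_true, h3, one_mul]
    · intro c _ hc
      have hne : (a : ℕ) + b + c ≠ m - 1 := by
        intro h
        apply hc
        ext
        simp only
        omega
      simp [hne]
    · intro h; exact absurd (Finset.mem_univ _) h
  · rw [dif_neg hab]
    symm
    refine Finset.sum_eq_zero fun c _ => ?_
    have : ¬ ((a : ℕ) + b + c < m) := by omega
    simp [this]

variable [Fintype Cl]

/-- **Engine of Theorem C_p.** If the triangle support `Tri` of a configuration with `m ≥ 2` classes
carries a re-weighting `Z` over some field with support exactly `Tri` and triangle rank `≤ m`, then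
every realization of `⟨3N,3N,3N⟩` in the `k`-th direct power satisfies
`N² e^{-4√(log N)} ≤ 3·(m·J(m))^k` (BCCGNSU Prop. 4.13 + the support-subrank principle).
[this work; the slice-rank count is BCCGNSU 2017 Prop. 4.13, proved in the tree] -/
theorem realizationPow_behrend_le_of_hasTriangleRankLE {m : ℕ} (hm : 2 ≤ m)
    (hCl : Fintype.card Cl = m) (Tri : Cl → Cl → Cl → Prop) (Z : Cl → Cl → Cl → K)
    (hZ : ∀ u v w, Z u v w ≠ 0 ↔ Tri u v w) (hT : HasTriangleRankLE Z m) (k N : ℕ)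
    (α β γ : Fin (3 * N) × Fin (3 * N) → (Fin k → Cl))
    (hreal : ∀ x y z : Fin (3 * N) × Fin (3 * N),
      (∀ ℓ, Tri (α x ℓ) (β y ℓ) (γ z ℓ)) ↔ (y.1 = x.2 ∧ z = (y.2, x.1))) :
    (N : ℝ) ^ 2 * Real.exp (-4 * Real.sqrt (Real.log N)) ≤ 3 * ((m : ℝ) * bccgnsuJ m) ^ k := by
  have h1 := realizationPow_behrend_le_sliceRank Tri Z hZ k N α β γ hreal
  have h2 := (BCCGNSU2017_prop413_holds m hm hCl hCl hCl Z hT).2 k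
  linarith

/-- **Engine of Theorem C_p, truncated-convolution form.** If the triangle support of a configuration
with `m ≥ 2` classes is exactly the support of a truncated convolution
`Σ_{a+b<m} Λ_{x,a} Λ_{y,b} M_{a+b,z}` over some field (e.g. the class-basis structure tensor of a
modular adjacency algebra `≅ K[s]/(s^m)`), then every realization of `⟨3N,3N,3N⟩` in the `k`-th
direct power satisfies `N² e^{-4√(log N)} ≤ 3·(m·J(m))^k`. [this work] -/
theorem realizationPow_behrend_le_of_truncatedConvolution {m : ℕ} (hm : 2 ≤ m)
    (hCl : Fintype.card Cl = m) (Tri : Cl → Cl → Cl → Prop) (Λ : Cl → Fin m → K)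
    (M : Fin m → Cl → K) (Z : Cl → Cl → Cl → K)
    (hF : ∀ x y z, Z x y z = ∑ a : Fin m, ∑ b : Fin m,
      if h : (a : ℕ) + b < m then Λ x a * Λ y b * M ⟨a + b, h⟩ z else 0)
    (hZ : ∀ u v w, Z u v w ≠ 0 ↔ Tri u v w) (k N : ℕ)
    (α β γ : Fin (3 * N) × Fin (3 * N) → (Fin k → Cl))
    (hreal : ∀ x y z : Fin (3 * N) × Fin (3 * N),
      (∀ ℓ, Tri (α x ℓ) (β y ℓ) (γ z ℓ)) ↔ (y.1 = x.2 ∧ z = (y.2, x.1))) :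
    (N : ℝ) ^ 2 * Real.exp (-4 * Real.sqrt (Real.log N)) ≤ 3 * ((m : ℝ) * bccgnsuJ m) ^ k :=
  realizationPow_behrend_le_of_hasTriangleRankLE hm hCl Tri Z hZ
    (hasTriangleRankLE_of_truncatedConvolution m Λ M Z hF) k N α β γ hreal

end Summit.MatrixMultiplication.MatrixMultiplication.Theorems.SupportSubrank
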